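import Summits.NavierStokesRegularity.OSWSelfSimilar.SheetNSLineTorusCascade
import HarnessLib

/-!
# Viscous CLM on the torus (`a = 0`, `σ = 2`): the FINITE-HORIZON cascade and its canonical
# extension to a global `IsSineCascade`

HONEST FRAMING (cell ns-blowup GROUP B «PROFILE SEARCH», zone Z3, row Z3-U addendum A-F2 of
`HOME/profile/z3/CENSUS-Z3.md`; human rulings D-0035/D-0074): **1-D MODEL (viscous Constantin–Lax–Majda
equation on `𝕋`); ODE calculus on Fourier-coefficient families, kernel-checked; not Euler, not Navier–Stokes;
«violates: none — MODEL».**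

WHY. The ten landed cascade files (`SheetNSLineTorusCascade*`) speak about `IsSineCascade ν c e`: a family of
modes solving the lower-triangular system (C) `ė_k = ½ Σ_{i+j=k} e_i e_j − ν k² e_k` for ALL `t > 0`. The Fourier
modes of a classical solution of the PDE that lives on a finite time interval `[0, T]` only give the system on
`(0, T)` (`IsSineCascadeOn ν c T e` below). Since (C) is triangular with LINEAR diagonal part, every finite-horizon
solution continues canonically and uniquely past `T` by Duhamel's formula, mode by mode (strong recursion on `k`):
`E_k(t) = e^{−νk²(t−T)} (e_k(T) + ∫_T^t e^{νk²(s−T)} ½Σ_{i+j=k} E_i(s)E_j(s) ds)` for `t > T`. The theorem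
`IsSineCascadeOn.exists_extend` packages this: **every finite-horizon cascade on `[0, T]` (`T > 0`) is the
restriction of a global `IsSineCascade`**, so `pole_lower_bound`, `unbounded_of_le`, `tail_induction`,
`movingPole_tail_induction`, … apply verbatim to coefficient families that are only known on `[0, T]` — the form
in which the PDE ↔ cascade link (`SheetNSLineTorusCascadeLink`) delivers them.

* `IsSineCascadeOn ν c T e` — (C) on `(0, T)`, continuity on `[0, T]`, `e 0 = 0` on `[0, T]`, sine datum;
* `IsSineCascade.restrict` — the global structure restricts to every horizon;
* `conv`, `duhamel`, `extendModes` — the convolution forcing, the one-mode Duhamel continuation, and the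
  recursively glued family (`WellFounded.fix` on `k`), with the unfolding `extendModes_eq`;
* `extendModes_eq_of_mem_Icc` — agreement with `e` on `[0, T]`; `continuousOn_extendModes`;
  `hasDerivAt_extendModes` — (C) at every `t > 0` (interior of `[0,T]`: the hypothesis; `t > T`: product rule +
  FTC; the junction `t = T`: one-sided derivative limit from the left, `hasDerivWithinAt_Iic_of_tendsto_deriv`,
  glued with the right derivative of the Duhamel branch by `HasDerivWithinAt.union`);
* **`IsSineCascadeOn.exists_extend`** — `0 < T → IsSineCascadeOn ν c T e → ∃ E, IsSineCascade ν c E ∧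
  ∀ k, ∀ t ∈ [0, T], E k t = e k t`.

bears_on: LADDER-NS N5 / zone Z3 (row Z3-U, A-F2) → N1 linear core. WHAT THIS IS NOT: not NS; no PDE object here
(pure ODE bookkeeping); the extension past `T` is a device — it is NOT claimed to be the coefficient family of any
PDE solution beyond `T`.
-/

noncomputable section

namespace Summit.NavierStokesRegularity.OSWSelfSimilar
namespace SheetNSLineTorusCascade

open Finset Real Set Filter MeasureTheory intervalIntegral
open scoped Topology

/-! ### The finite-horizon structure -/

/-- **The sine-datum cascade on a finite horizon `[0, T]`.** As `IsSineCascade`, but the system (C) is only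
required on `(0, T)`, continuity on `[0, T]`, and the mean-zero condition `e 0 = 0` on `[0, T]`.
[new here — MODEL] -/
structure IsSineCascadeOn (ν c T : ℝ) (e : ℕ → ℝ → ℝ) : Prop where
  /-- mode `0` vanishes on `[0, T]` (mean-zero class) -/
  zero : ∀ t ∈ Icc (0 : ℝ) T, e 0 t = 0
  /-- every mode is continuous on `[0, T]` -/
  cont : ∀ k, ContinuousOn (e k) (Icc 0 T)
  /-- the cascade (C) on `(0, T)` -/
  ode : ∀ k : ℕ, ∀ t ∈ Ioo (0 : ℝ) T,
    HasDerivAt (e k) ((1 / 2) * (∑ p ∈ antidiagonal k, e p.1 t * e p.2 t) - ν * (k : ℝ) ^ 2 * e k t) t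
  /-- sine datum: `c_1(0) = c` -/
  one_init : e 1 0 = c
  /-- sine datum: `c_k(0) = 0` for `k ≥ 2` -/
  init_zero : ∀ k, 2 ≤ k → e k 0 = 0

variable {ν c T : ℝ} {e : ℕ → ℝ → ℝ}

/-- A global cascade restricts to every finite horizon. [new here — MODEL] -/
theorem IsSineCascade.restrict (he : IsSineCascade ν c e) (T : ℝ) : IsSineCascadeOn ν c T e where
  zero t _ := he.zero t
  cont k := (he.cont k).mono Icc_subset_Ici_self
  ode k t ht := he.ode k t ht.1
  one_init := he.one_init
  init_zero := he.init_zero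

/-! ### The Duhamel continuation -/

/-- The convolution forcing of mode `k` built from a family `G`: `½ Σ_{i+j=k} G_i G_j`. [new here — MODEL] -/
def conv (G : ℕ → ℝ → ℝ) (k : ℕ) (t : ℝ) : ℝ := (1 / 2) * ∑ p ∈ antidiagonal k, G p.1 t * G p.2 t

/-- One-mode Duhamel continuation past `T` with rate `μ`, value `a` at `T` and forcing `φ`:
`e^{−μ(t−T)} (a + ∫_T^t e^{μ(s−T)} φ(s) ds)`. [new here — MODEL] -/
def duhamel (T μ a : ℝ) (φ : ℝ → ℝ) (t : ℝ) : ℝ :=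
  exp (-(μ * (t - T))) * (a + ∫ s in T..t, exp (μ * (s - T)) * φ s)

/-- The glued mode `k` given the already-extended lower modes `L` (`L j` for `j < k`, zero above): `0` for `k = 0`;
`e k` up to time `T`; the Duhamel continuation after `T`. [new here — MODEL] -/
def glueMode (ν T : ℝ) (e : ℕ → ℝ → ℝ) (k : ℕ) (L : ℕ → ℝ → ℝ) (t : ℝ) : ℝ :=
  if k = 0 then 0 else if t ≤ T then e k t else duhamel T (ν * (k : ℝ) ^ 2) (e k T) (conv L k) t

/-- **The canonical extension** of a finite-horizon family past `T`, all modes at once, by well-founded recursion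
on the mode number. [new here — MODEL] -/
def extendModes (ν T : ℝ) (e : ℕ → ℝ → ℝ) : ℕ → ℝ → ℝ :=
  WellFounded.fix (C := fun _ => ℝ → ℝ) wellFounded_lt
    (fun k ih => glueMode ν T e k (fun j => if h : j < k then ih j h else fun _ => 0))

/-- The lower family seen by mode `k`: the extension below `k`, zero from `k` on. [new here — MODEL] -/
def lowerModes (ν T : ℝ) (e : ℕ → ℝ → ℝ) (k : ℕ) : ℕ → ℝ → ℝ :=
  fun j => if j < k then extendModes ν T e j else fun _ => 0

/-- Unfolding of the recursion. -/
theorem extendModes_eq (ν T : ℝ) (e : ℕ → ℝ → ℝ) (k : ℕ) :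
    extendModes ν T e k = glueMode ν T e k (lowerModes ν T e k) := by
  rw [extendModes, WellFounded.fix_eq]
  rfl

/-- Mode `0` of the extension vanishes identically. -/
theorem extendModes_zero (ν T : ℝ) (e : ℕ → ℝ → ℝ) (t : ℝ) : extendModes ν T e 0 t = 0 := by
  rw [extendModes_eq]; simp [glueMode]

/-- Up to time `T` the extension of mode `k ≥ 1` is `e k`. -/
theorem extendModes_of_le (ν : ℝ) {T : ℝ} (e : ℕ → ℝ → ℝ) {k : ℕ} (hk : k ≠ 0) {t : ℝ} (ht : t ≤ T) :
    extendModes ν T e k t = e k t := by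
  rw [extendModes_eq]; simp [glueMode, hk, ht]

/-- After time `T` the extension of mode `k ≥ 1` is the Duhamel continuation. -/
theorem extendModes_of_lt (ν : ℝ) {T : ℝ} (e : ℕ → ℝ → ℝ) {k : ℕ} (hk : k ≠ 0) {t : ℝ} (ht : T < t) :
    extendModes ν T e k t = duhamel T (ν * (k : ℝ) ^ 2) (e k T) (conv (lowerModes ν T e k) k) t := by
  rw [extendModes_eq]; simp [glueMode, hk, not_le.mpr ht]

/-- At time `T` the Duhamel continuation takes the value `e k T`. -/
theorem duhamel_self (T μ a : ℝ) (φ : ℝ → ℝ) : duhamel T μ a φ T = a := by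
  simp [duhamel]

/-- From time `T` on, the extension of mode `k ≥ 1` coincides with the Duhamel continuation (including `t = T`). -/
theorem extendModes_of_ge (ν : ℝ) {T : ℝ} (e : ℕ → ℝ → ℝ) {k : ℕ} (hk : k ≠ 0) {t : ℝ} (ht : T ≤ t) :
    extendModes ν T e k t = duhamel T (ν * (k : ℝ) ^ 2) (e k T) (conv (lowerModes ν T e k) k) t := by
  rcases eq_or_lt_of_le ht with rfl | ht'
  · rw [extendModes_of_le ν e hk le_rfl, duhamel_self]
  · exact extendModes_of_lt ν e hk ht'

/-- **Agreement on `[0, T]`** (all modes; uses `e 0 = 0` there). [new here — MODEL] -/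
theorem extendModes_eq_of_mem_Icc (he : IsSineCascadeOn ν c T e) (k : ℕ) {t : ℝ} (ht : t ∈ Icc (0 : ℝ) T) :
    extendModes ν T e k t = e k t := by
  rcases eq_or_ne k 0 with rfl | hk
  · rw [extendModes_zero, he.zero t ht]
  · exact extendModes_of_le ν e hk ht.2

/-- The convolution forcing seen through the lower family equals the full convolution of the extension (the two
dropped terms `(0,k)`, `(k,0)` carry the factor `E 0 = 0`). [new here — MODEL] -/
theorem conv_lowerModes_eq (ν T : ℝ) (e : ℕ → ℝ → ℝ) (k : ℕ) (t : ℝ) :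
    conv (lowerModes ν T e k) k t = conv (extendModes ν T e) k t := by
  unfold conv
  congr 1
  refine sum_congr rfl fun p hp => ?_
  have hsum : p.1 + p.2 = k := mem_antidiagonal.mp hp
  have hL : ∀ j, lowerModes ν T e k j t = if j < k then extendModes ν T e j t else 0 := by
    intro j
    unfold lowerModes
    split_ifs <;> rfl
  rw [hL, hL]
  rcases Nat.eq_zero_or_pos p.1 with h1 | h1
  · rw [h1, extendModes_zero]
    simp
  rcases Nat.eq_zero_or_pos p.2 with h2 | h2
  · rw [h2, extendModes_zero]
    simp
  rw [if_pos (by omega), if_pos (by omega)]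

/-! ### Calculus of the Duhamel continuation -/

/-- **Derivative of the Duhamel continuation.** If the forcing `φ` is interval-integrable against the weight on
`[T, t]`, measurable near `t` and continuous at `t`, then `duhamel T μ a φ` has derivative `φ t − μ·(duhamel … t)`
at `t` (product rule + FTC). [new here — MODEL] -/
theorem hasDerivAt_duhamel {T μ a : ℝ} {φ : ℝ → ℝ} {t : ℝ}
    (hint : IntervalIntegrable (fun s => exp (μ * (s - T)) * φ s) volume T t)
    (hmeas : StronglyMeasurableAtFilter (fun s => exp (μ * (s - T)) * φ s) (𝓝 t))
    (hcont : ContinuousAt φ t) :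
    HasDerivAt (duhamel T μ a φ) (φ t - μ * duhamel T μ a φ t) t := by
  unfold duhamel
  have h1 : HasDerivAt (fun s => exp (-(μ * (s - T)))) (exp (-(μ * (t - T))) * (-μ)) t := by
    have h := ((hasDerivAt_id t).sub_const T).const_mul μ |>.neg.exp
    simpa using h
  have hcont' : ContinuousAt (fun s => exp (μ * (s - T)) * φ s) t :=
    ((continuous_exp.comp (continuous_const.mul (continuous_id.sub continuous_const))).continuousAt).mul hcont
  have h2 : HasDerivAt (fun s => a + ∫ x in T..s, exp (μ * (x - T)) * φ x) (exp (μ * (t - T)) * φ t) t := by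
    have h := intervalIntegral.integral_hasDerivAt_right hint hmeas hcont'
    simpa using h.const_add a
  refine (h1.mul h2).congr_deriv ?_
  have hee : exp (-(μ * (t - T))) * exp (μ * (t - T)) = 1 := by rw [← exp_add]; simp
  set J := a + ∫ x in T..t, exp (μ * (x - T)) * φ x
  calc exp (-(μ * (t - T))) * -μ * J + exp (-(μ * (t - T))) * (exp (μ * (t - T)) * φ t)
      = (exp (-(μ * (t - T))) * exp (μ * (t - T))) * φ t - μ * (exp (-(μ * (t - T))) * J) := by ring
    _ = φ t - μ * (exp (-(μ * (t - T))) * J) := by rw [hee, one_mul]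

/-! ### Continuity and the system (C) for the extension -/

section extension

variable (he : IsSineCascadeOn ν c T e) (hT : 0 < T)
include he hT

omit he hT in
/-- The convolution forcing of the extension at mode `k` is continuous on `[0, ∞)` once the lower modes are.
[new here — MODEL] -/
theorem continuousOn_conv_of_lower {k : ℕ} (ih : ∀ j < k, ContinuousOn (extendModes ν T e j) (Ici 0)) :
    ContinuousOn (conv (extendModes ν T e) k) (Ici 0) := by
  unfold conv
  refine continuousOn_const.mul (continuousOn_finsetSum _ fun p hp => ?_)
  have hsum : p.1 + p.2 = k := mem_antidiagonal.mp hp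
  rcases Nat.eq_zero_or_pos p.1 with h1 | h1
  · have : (fun t => extendModes ν T e p.1 t * extendModes ν T e p.2 t) = fun _ => 0 := by
      funext t; rw [h1, extendModes_zero, zero_mul]
    rw [this]; exact continuousOn_const
  rcases Nat.eq_zero_or_pos p.2 with h2 | h2
  · have : (fun t => extendModes ν T e p.1 t * extendModes ν T e p.2 t) = fun _ => 0 := by
      funext t; rw [h2, extendModes_zero, mul_zero]
    rw [this]; exact continuousOn_const
  exact (ih p.1 (by omega)).mul (ih p.2 (by omega))

omit he in
/-- The Duhamel branch of mode `k ≥ 1` has, at every `t > 0`, the derivative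
`conv E k t − νk² · (duhamel … t)` — provided the lower modes are continuous on `[0, ∞)`. [new here — MODEL] -/
theorem hasDerivAt_duhamelBranch {k : ℕ} (ih : ∀ j < k, ContinuousOn (extendModes ν T e j) (Ici 0))
    {t : ℝ} (ht : 0 < t) :
    HasDerivAt (duhamel T (ν * (k : ℝ) ^ 2) (e k T) (conv (lowerModes ν T e k) k))
      (conv (extendModes ν T e) k t
        - ν * (k : ℝ) ^ 2 * duhamel T (ν * (k : ℝ) ^ 2) (e k T) (conv (lowerModes ν T e k) k) t) t := by
  have hconvE : ContinuousOn (conv (extendModes ν T e) k) (Ici 0) := continuousOn_conv_of_lower ih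
  have hfun : conv (lowerModes ν T e k) k = conv (extendModes ν T e) k := by
    funext s; exact conv_lowerModes_eq ν T e k s
  rw [hfun]
  set μ := ν * (k : ℝ) ^ 2
  set g : ℝ → ℝ := fun s => exp (μ * (s - T)) * conv (extendModes ν T e) k s with hg
  have hgc : ContinuousOn g (Ici 0) :=
    ((continuous_exp.comp (continuous_const.mul (continuous_id.sub continuous_const))).continuousOn).mul hconvE
  have hint : IntervalIntegrable g volume T t :=
    (hgc.mono (by
      intro s hs
      rcases le_total T t with h | h
      · rw [uIcc_of_le h] at hs; exact le_trans hT.le hs.1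
      · rw [uIcc_of_ge h] at hs; exact le_trans ht.le hs.1)).intervalIntegrable
  have hmeas : StronglyMeasurableAtFilter g (𝓝 t) :=
    (hgc.mono Ioi_subset_Ici_self).stronglyMeasurableAtFilter isOpen_Ioi _ ht
  have hcont : ContinuousAt (conv (extendModes ν T e) k) t :=
    hconvE.continuousAt (Ici_mem_nhds ht)
  exact hasDerivAt_duhamel hint hmeas hcont

/-- **Every mode of the extension is continuous on `[0, ∞)`** (strong induction on `k`: on `[0, T]` it is `e k`,
on `[T, ∞)` the Duhamel branch, differentiable at every `t > 0`). [new here — MODEL] -/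
theorem continuousOn_extendModes : ∀ k, ContinuousOn (extendModes ν T e k) (Ici 0) := by
  intro k
  induction k using Nat.strong_induction_on with
  | _ k ih =>
    rcases eq_or_ne k 0 with rfl | hk
    · have : extendModes ν T e 0 = fun _ => 0 := funext (extendModes_zero ν T e)
      rw [this]; exact continuousOn_const
    have hIci : Ici (0 : ℝ) = Icc 0 T ∪ Ici T := by
      ext s; constructor
      · intro hs
        rcases le_total s T with h | h
        · exact Or.inl ⟨hs, h⟩
        · exact Or.inr h
      · rintro (hs | hs)
        · exact hs.1
        · exact le_trans hT.le hs
    rw [hIci]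
    refine ContinuousOn.union_of_isClosed ?_ ?_ isClosed_Icc isClosed_Ici
    · exact (he.cont k).congr fun s hs => extendModes_of_le ν e hk hs.2
    · have hD : ContinuousOn (duhamel T (ν * (k : ℝ) ^ 2) (e k T) (conv (lowerModes ν T e k) k)) (Ici T) :=
        fun s hs => (hasDerivAt_duhamelBranch hT ih (lt_of_lt_of_le hT hs)).continuousAt.continuousWithinAt
      exact hD.congr fun s hs => extendModes_of_ge ν e hk hs

omit hT in
/-- The full right-hand side of (C) for the extension at mode `k`, time `t`. -/
private theorem rhs_eq_of_mem_Icc (k : ℕ) {t : ℝ} (ht : t ∈ Icc (0 : ℝ) T) :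
    (1 / 2) * (∑ p ∈ antidiagonal k, extendModes ν T e p.1 t * extendModes ν T e p.2 t)
        - ν * (k : ℝ) ^ 2 * extendModes ν T e k t
      = (1 / 2) * (∑ p ∈ antidiagonal k, e p.1 t * e p.2 t) - ν * (k : ℝ) ^ 2 * e k t := by
  rw [extendModes_eq_of_mem_Icc he k ht]
  congr 2
  exact sum_congr rfl fun p _ => by rw [extendModes_eq_of_mem_Icc he p.1 ht, extendModes_eq_of_mem_Icc he p.2 ht]

/-- **The extension solves (C) at every `t > 0`.** [new here — MODEL] -/
theorem hasDerivAt_extendModes (k : ℕ) {t : ℝ} (ht : 0 < t) :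
    HasDerivAt (extendModes ν T e k)
      ((1 / 2) * (∑ p ∈ antidiagonal k, extendModes ν T e p.1 t * extendModes ν T e p.2 t)
        - ν * (k : ℝ) ^ 2 * extendModes ν T e k t) t := by
  rcases eq_or_ne k 0 with rfl | hk
  · -- mode 0: identically zero, and the right-hand side vanishes
    have h0 : extendModes ν T e 0 = fun _ => 0 := funext (extendModes_zero ν T e)
    have hr : (1 / 2) * (∑ p ∈ antidiagonal 0, extendModes ν T e p.1 t * extendModes ν T e p.2 t)
        - ν * ((0 : ℕ) : ℝ) ^ 2 * extendModes ν T e 0 t = 0 := by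
      simp [extendModes_zero]
    rw [hr, h0]
    exact hasDerivAt_const t 0
  have hcontE := continuousOn_extendModes he hT
  -- the Duhamel branch and its derivative at `t`
  set D := duhamel T (ν * (k : ℝ) ^ 2) (e k T) (conv (lowerModes ν T e k) k) with hDdef
  have hD : HasDerivAt D (conv (extendModes ν T e) k t - ν * (k : ℝ) ^ 2 * D t) t :=
    hasDerivAt_duhamelBranch hT (fun j _ => hcontE j) ht
  have hconv : conv (extendModes ν T e) k t
      = (1 / 2) * ∑ p ∈ antidiagonal k, extendModes ν T e p.1 t * extendModes ν T e p.2 t := rfl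
  rcases lt_trichotomy t T with htT | htT | hTt
  · -- interior of `[0, T]`: the hypothesis, transported
    have heq : extendModes ν T e k =ᶠ[𝓝 t] e k := by
      filter_upwards [Iio_mem_nhds htT] with s hs using extendModes_of_le ν e hk hs.le
    rw [rhs_eq_of_mem_Icc he k ⟨ht.le, htT.le⟩]
    exact (he.ode k t ⟨ht, htT⟩).congr_of_eventuallyEq heq
  · -- the junction `t = T`
    rw [htT]
    have hval : extendModes ν T e k T = e k T := extendModes_of_le ν e hk le_rfl
    have hDT : D T = e k T := by rw [hDdef, duhamel_self]
    -- right: the Duhamel branch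
    have hright : HasDerivWithinAt (extendModes ν T e k)
        (conv (extendModes ν T e) k T - ν * (k : ℝ) ^ 2 * D T) (Ici T) T := by
      have hD' : HasDerivAt D (conv (extendModes ν T e) k T - ν * (k : ℝ) ^ 2 * D T) T :=
        hasDerivAt_duhamelBranch hT (fun j _ => hcontE j) hT
      exact hD'.hasDerivWithinAt.congr (fun s hs => extendModes_of_ge ν e hk hs) (extendModes_of_ge ν e hk le_rfl)
    -- left: derivative limit of `e k` from inside `(0, T)`
    set R : ℝ → ℝ := fun s => (1 / 2) * (∑ p ∈ antidiagonal k, e p.1 s * e p.2 s) - ν * (k : ℝ) ^ 2 * e k s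
      with hR
    have hRc : ContinuousOn R (Icc 0 T) := by
      refine (continuousOn_const.mul (continuousOn_finsetSum _ fun p _ => ?_)).sub
        (continuousOn_const.mul (he.cont k))
      exact (he.cont p.1).mul (he.cont p.2)
    have hdiff : DifferentiableOn ℝ (e k) (Ioo 0 T) :=
      fun s hs => (he.ode k s hs).differentiableAt.differentiableWithinAt
    have hderiv : ∀ s ∈ Ioo 0 T, deriv (e k) s = R s := fun s hs => (he.ode k s hs).deriv
    have hcont : ContinuousWithinAt (e k) (Ioo 0 T) T :=
      ((he.cont k).continuousWithinAt ⟨hT.le, le_rfl⟩).mono Ioo_subset_Icc_self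
    have hlim : Tendsto (fun s => deriv (e k) s) (𝓝[<] T) (𝓝 (R T)) := by
      have h1 : Tendsto R (𝓝[<] T) (𝓝 (R T)) := by
        have h2 : ContinuousWithinAt R (Ioo 0 T) T :=
          (hRc.continuousWithinAt ⟨hT.le, le_rfl⟩).mono Ioo_subset_Icc_self
        have h3 : 𝓝[<] T ≤ 𝓝[Ioo 0 T] T := nhdsWithin_le_iff.mpr (Ioo_mem_nhdsLT hT)
        exact h2.tendsto.mono_left h3
      refine h1.congr' ?_
      filter_upwards [Ioo_mem_nhdsLT hT] with s hs using (hderiv s hs).symm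
    have hleft' : HasDerivWithinAt (e k) (R T) (Iic T) T :=
      hasDerivWithinAt_Iic_of_tendsto_deriv hdiff hcont (Ioo_mem_nhdsLT hT) hlim
    have hleft : HasDerivWithinAt (extendModes ν T e k) (R T) (Iic T) T :=
      hleft'.congr (fun s hs => extendModes_of_le ν e hk hs) hval
    -- the two one-sided values agree
    have hRT : R T = conv (extendModes ν T e) k T - ν * (k : ℝ) ^ 2 * D T := by
      simp only [hR, hDT, conv]
      congr 2
      exact sum_congr rfl fun p _ => by
        rw [extendModes_eq_of_mem_Icc he p.1 ⟨hT.le, le_rfl⟩, extendModes_eq_of_mem_Icc he p.2 ⟨hT.le, le_rfl⟩]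
    rw [hRT] at hleft
    have hunion := hleft.union hright
    rw [Iic_union_Ici, hasDerivWithinAt_univ] at hunion
    have hrhs : (1 / 2) * (∑ p ∈ antidiagonal k, extendModes ν T e p.1 T * extendModes ν T e p.2 T)
        - ν * (k : ℝ) ^ 2 * extendModes ν T e k T = conv (extendModes ν T e) k T - ν * (k : ℝ) ^ 2 * D T := by
      rw [hval, hDT]; rfl
    rw [hrhs]
    exact hunion
  · -- past `T`: the Duhamel branch
    have heq : extendModes ν T e k =ᶠ[𝓝 t] D := by
      filter_upwards [Ioi_mem_nhds hTt] with s hs using extendModes_of_lt ν e hk hs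
    have hval : extendModes ν T e k t = D t := extendModes_of_lt ν e hk hTt
    rw [← hconv, hval]
    exact hD.congr_of_eventuallyEq heq

/-- **Every finite-horizon sine cascade (`T > 0`) is the restriction of a global one.** [new here — MODEL] -/
theorem IsSineCascadeOn.exists_extend :
    ∃ E : ℕ → ℝ → ℝ, IsSineCascade ν c E ∧ ∀ k, ∀ t ∈ Icc (0 : ℝ) T, E k t = e k t := by
  refine ⟨extendModes ν T e, ?_, fun k t ht => extendModes_eq_of_mem_Icc he k ht⟩
  exact
    { zero := extendModes_zero ν T e
      cont := continuousOn_extendModes he hT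
      ode := fun k t ht => hasDerivAt_extendModes he hT k ht
      one_init := by
        rw [extendModes_eq_of_mem_Icc he 1 ⟨le_rfl, hT.le⟩]; exact he.one_init
      init_zero := fun k hk => by
        rw [extendModes_eq_of_mem_Icc he k ⟨le_rfl, hT.le⟩]; exact he.init_zero k hk }

end extension

/-- **Transfer of the blow-up theorem to finite horizons.** A finite-horizon sine cascade with `ν > 0` and
`48ν ≤ c` cannot have bounded modes at time `log 2/ν` if its horizon reaches that time: if `log 2/ν ≤ T` then
`k ↦ e k (log 2/ν)` is unbounded (`unbounded_of_le` applied to the canonical extension, which agrees with `e`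
there). [new here — MODEL] -/
theorem IsSineCascadeOn.unbounded_of_le (he : IsSineCascadeOn ν c T e) (hν : 0 < ν) (hc : 48 * ν ≤ c)
    (hT : log 2 / ν ≤ T) : ∀ M : ℝ, ∃ k : ℕ, M < e k (log 2 / ν) := by
  have hlog : 0 < log 2 / ν := div_pos (log_pos (by norm_num)) hν
  have hT0 : 0 < T := lt_of_lt_of_le hlog hT
  obtain ⟨E, hE, hEe⟩ := he.exists_extend hT0
  intro M
  obtain ⟨k, hk⟩ := SheetNSLineTorusCascade.unbounded_of_le hE hν hc M
  exact ⟨k, by rwa [hEe k _ ⟨hlog.le, hT⟩] at hk⟩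

/-- The census form on a finite horizon: bounded modes at time `log 2/ν ≤ T` force `c < 48ν`.
[new here — MODEL] -/
theorem IsSineCascadeOn.datum_lt_of_bounded (he : IsSineCascadeOn ν c T e) (hν : 0 < ν) (hT : log 2 / ν ≤ T)
    (hbdd : ∃ M : ℝ, ∀ k : ℕ, e k (log 2 / ν) ≤ M) : c < 48 * ν := by
  by_contra h
  obtain ⟨M, hM⟩ := hbdd
  obtain ⟨k, hk⟩ := he.unbounded_of_le hν (not_lt.mp h) hT M
  exact absurd (hM k) (not_le.mpr hk)

end SheetNSLineTorusCascade
end Summit.NavierStokesRegularity.OSWSelfSimilar
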